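import Summits.HubbardSuperconductivity.HubbardSuperconductivity.Theorems.AnisotropyChordTransferFibre3DiagRotation

/-!
# Route `AnisotropyChord` / H0 rotor rung: PartN37 — `DiagRotation` AS TYPED fails at `L = 3` (Lean witness of the typing slip)

Companion of `…Fibre3DiagRotation` (`diag_rotation`: the diagonal rotation identity with the parity offset cast in `ℕ`,
proved for every `L, λ, n`; `diagRotation_iff_even_rows`: the ported `Prop` reads `p % 2` in `ℝ`, where it is `0`).
Here: `not_diagRotation_three : ¬ DiagRotation 3` — at `L = 3`, `λ = 1 ∈ (0, 2ε₁) = (0, 3)`, `n = 1` the true value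
`2V·a(1,1;1) = 36/5` (all `cos(πm/3)` are `±1, ±1/2`) differs from the even-rows double sum `81/10`.
(`DiagRotation 2` happens to hold — the odd rows have `cos(πp/2) = 0` — so `3` is the least witness; numerically the
typed reading fails for every tested `L ≥ 3`.)  REPAIR for the statement file: `Real.cos (Real.pi * ((2 * j + p % 2 : ℕ) : ℝ) / L)`.
Prover seat `hubbard-h0-rotor-p3` g2; helper for stmt-HubbardSuperconductivity-19089 (`--supports`, helper class).
Nothing here proves superconductivity in the Hubbard model; helper lemmas of ONE conditional reduction (rung 19089).
-/

set_option linter.dupNamespace false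
set_option autoImplicit false

noncomputable section

open scoped BigOperators

namespace Summit.HubbardSuperconductivity.HubbardSuperconductivity.Theorems.AnisotropyChord.Transfer.Fibre3

/-- the table `cos(πm/3)`, `m mod 6 = 0,…,5 ↦ 1, 1/2, −1/2, −1, −1/2, 1/2`. [folklore] -/
theorem cos_pi_mul_div_three (m : ℕ) :
    Real.cos (Real.pi * (m : ℝ) / ((3 : ℕ) : ℝ))
      = if m % 6 = 0 then 1 else if m % 6 = 1 then 1 / 2 else if m % 6 = 2 then -1 / 2
        else if m % 6 = 3 then -1 else if m % 6 = 4 then -1 / 2 else 1 / 2 := by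
  have hm : (m : ℝ) = 6 * ((m / 6 : ℕ) : ℝ) + ((m % 6 : ℕ) : ℝ) := by
    exact_mod_cast (Nat.div_add_mod m 6).symm
  have hper : Real.cos (Real.pi * (m : ℝ) / ((3 : ℕ) : ℝ)) = Real.cos (Real.pi * ((m % 6 : ℕ) : ℝ) / 3) := by
    rw [hm, show Real.pi * (6 * ((m / 6 : ℕ) : ℝ) + ((m % 6 : ℕ) : ℝ)) / ((3 : ℕ) : ℝ)
      = Real.pi * ((m % 6 : ℕ) : ℝ) / 3 + ((m / 6 : ℕ) : ℝ) * (2 * Real.pi) by push_cast; ring,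
      Real.cos_add_nat_mul_two_pi]
  rw [hper]
  have hb : m % 6 < 6 := Nat.mod_lt _ (by norm_num)
  generalize m % 6 = b at hb ⊢
  interval_cases b
  · simp
  · rw [show Real.pi * ((1 : ℕ) : ℝ) / 3 = Real.pi / 3 by push_cast; ring, Real.cos_pi_div_three]
    simp
  · rw [show Real.pi * ((2 : ℕ) : ℝ) / 3 = Real.pi - Real.pi / 3 by push_cast; ring, Real.cos_pi_sub,
      Real.cos_pi_div_three]
    norm_num
  · rw [show Real.pi * ((3 : ℕ) : ℝ) / 3 = Real.pi by push_cast; ring, Real.cos_pi]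
    simp
  · rw [show Real.pi * ((4 : ℕ) : ℝ) / 3 = Real.pi / 3 + Real.pi by push_cast; ring, Real.cos_add_pi,
      Real.cos_pi_div_three]
    norm_num
  · rw [show Real.pi * ((5 : ℕ) : ℝ) / 3 = 2 * Real.pi - Real.pi / 3 by push_cast; ring, Real.cos_two_pi_sub,
      Real.cos_pi_div_three]
    norm_num

/-- `ε₁ = 3/2` at `L = 3`. [folklore] -/
theorem eps1_three : eps1 3 = 3 / 2 := by
  unfold eps1
  rw [show 2 * Real.pi / ((3 : ℕ) : ℝ) = Real.pi - Real.pi / 3 by push_cast; ring, Real.cos_pi_sub,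
    Real.cos_pi_div_three]
  norm_num

/-- **`DiagRotation 3` is FALSE as typed** (the `ℝ`-valued `p % 2 = 0` makes every row an even row):
witness `λ = 1`, `n = 1`, true value `36/5` vs typed double sum `81/10`. -/
theorem not_diagRotation_three : ¬ DiagRotation 3 := by
  intro h
  have h' := (diagRotation_iff_even_rows 3).mp h 1 one_pos (by rw [eps1_three]; norm_num) 1
  rw [diag_rotation 3 1 1] at h'
  -- bring every cosine to the form `cos(π m / 3)` with `m : ℕ`
  have wt : ∀ p : ℕ, Real.cos (2 * Real.pi * ((1 : ℕ) : ℝ) * (p : ℝ) / ((3 : ℕ) : ℝ))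
      = Real.cos (Real.pi * ((2 * p : ℕ) : ℝ) / ((3 : ℕ) : ℝ)) := by
    intro p; congr 1; push_cast; ring
  have ev : ∀ j : ℕ, Real.cos (Real.pi * (2 * (j : ℝ)) / ((3 : ℕ) : ℝ))
      = Real.cos (Real.pi * ((2 * j : ℕ) : ℝ) / ((3 : ℕ) : ℝ)) := by
    intro j; congr 1; push_cast; ring
  simp only [wt, ev, cos_pi_mul_div_three, Finset.sum_range_succ, Finset.sum_range_zero] at h'
  norm_num at h'

end Summit.HubbardSuperconductivity.HubbardSuperconductivity.Theorems.AnisotropyChord.Transfer.Fibre3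

end
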